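import Summits.Ventures.LatticeQCDFlow.Scaling.ReplicaExchangeBareSampler

/-!
HONEST FRAMING: exact (Metropolis-corrected) sampling algorithms for lattice gauge theory; figures
of merit are autocorrelation/cost numbers at stated couplings and volumes; no continuum-physics
claim.

# ReplicaExchangeFlowSwap — REPLICA EXCHANGE WITH FLOW-ASSISTED SWAPS ON A FINITE CONFIGURATION SPACE: THE PAIR
# `(x_j, x_{j+1})` IS REPLACED BY `(φ_j⁻¹ x_{j+1}, φ_j x_j)` FOR A BIJECTION `φ_j` OF CONFIGURATIONS (a trained map
# transporting level `j` towards level `j+1`) AND METROPOLIS-CORRECTED AGAINST THE PRODUCT LAW; THE MOVE IS AN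
# INVOLUTION, THE SAMPLER IS EXACT (DETAILED BALANCE), AND `φ_j = id` IS THE PLAIN TAGLESS SAMPLER
# (lean-2 GEN-19, ours)

Venture-side (OURS).  Cell `lqcd-flow` (pub-lqcd), unit `pub-lqcd-lean-2-g19`, 2026-08-25.  Chapter R, the
flow-assisted variant of `Scaling/ReplicaExchangeBareSampler` (R1).  Motivation (value-free): normalizing flows are
proposed in the 2022–2024 literature not only as direct samplers but as MAPS BETWEEN NEIGHBOURING REPLICAS of a
tempering ladder, raising the swap acceptance; the exactness of such a scheme is the Metropolis correction of a
deterministic involutive proposal.  On a finite configuration space a volume-preserving map is a bijection, so the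
objects are: `φ : Fin K → Equiv.Perm S` (one bijection per adjacent pair), the FLOW SWAP
`flowSwapAt φ j x = update (update x j (φ_j⁻¹ (x (j+1)))) (j+1) (φ_j (x j))`, the proposal `ptFlowProposal φ`
(a uniform pair `j` proposes `flowSwapAt φ j x`), the Metropolis move `ptFlowSwap μ φ = mhKernel (ptFlowProposal φ)
(tensorFun μ)` and the sampler `ptFlowSampler t μ M φ = t·ptFlowSwap μ φ + (1−t)·prodKernel (K+1)⁻¹ M`.

## What is proved

* §1 **`flowSwapAt_flowSwapAt`** — the flow swap is an INVOLUTION; `flowSwapAt_refl` — with `φ_j = 1` it is the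
  plain exchange `x ∘ levelSwap j`; the proposal is symmetric, non-negative, of row mass `≤ 1`, `≥ 1/K` on each image.
* §2 `ptFlowSwap`, `ptFlowSampler`: ROW-STOCHASTIC, **DETAILED BALANCE** with the product law `⊗_k μ_k`
  (`0 ≤ t ≤ 1`, `μ_k > 0`, `M_k` row-stochastic and `μ_k`-reversible), stationarity; the off-diagonal flow formula
  `π̃(x)·FSw(x,y) = T(x,y)·min{π̃(x), π̃(y)}`; `ptFlowSampler_apply`; **`ptFlowSampler_refl`** — `φ = 1` recovers
  `ptBareSampler t μ M` exactly.

NOT CLAIMED: anything about rates (the sequel `Scaling/ReplicaExchangeFlowSwapDiffusive` shows that SECTOR-PRESERVING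
flows leave the diffusive ceiling of `Scaling/ReplicaExchangeDiffusive` unchanged); continuous configuration spaces
(Jacobians); how `φ_j` is obtained; anything measured.  Literature grade (cell rule): KNOWN ALGORITHM CLASS
(deterministic involutive proposals with Metropolis correction; flow-assisted replica exchange), NEW TYPING (finite
exact-sampler vocabulary of the tree); nothing cited as a fact; no new bib keys.
-/

noncomputable section

open Finset Function
open Literature.Probability.MarkovChains

namespace Summit.Ventures.LatticeQCDFlow.Scaling

variable {S : Type*} [Fintype S] [DecidableEq S] {K : ℕ}

/-! ## §1 The flow swap and its proposal -/

/-- THE FLOW SWAP of the pair `(j, j+1)`: level `j` receives `φ_j⁻¹` of the configuration at level `j+1`, level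
`j+1` receives `φ_j` of the configuration at level `j`. [ours] -/
def flowSwapAt (φ : Fin K → Equiv.Perm S) (j : Fin K) (x : Fin (K + 1) → S) : Fin (K + 1) → S :=
  update (update x j.castSucc ((φ j).symm (x j.succ))) j.succ (φ j (x j.castSucc))

omit [Fintype S] [DecidableEq S] in
/-- The flow swap at level `j+1`. [ours] -/
theorem flowSwapAt_succ (φ : Fin K → Equiv.Perm S) (j : Fin K) (x : Fin (K + 1) → S) :
    flowSwapAt φ j x j.succ = φ j (x j.castSucc) := by
  unfold flowSwapAt; rw [update_self]

omit [Fintype S] [DecidableEq S] in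
/-- The flow swap at level `j`. [ours] -/
theorem flowSwapAt_castSucc (φ : Fin K → Equiv.Perm S) (j : Fin K) (x : Fin (K + 1) → S) :
    flowSwapAt φ j x j.castSucc = (φ j).symm (x j.succ) := by
  have hne : j.castSucc ≠ j.succ := ne_of_lt Fin.castSucc_lt_succ
  unfold flowSwapAt; rw [update_of_ne hne, update_self]

omit [Fintype S] [DecidableEq S] in
/-- The flow swap off the pair. [ours] -/
theorem flowSwapAt_of_ne (φ : Fin K → Equiv.Perm S) (j : Fin K) (x : Fin (K + 1) → S) {i : Fin (K + 1)}
    (h1 : i ≠ j.castSucc) (h2 : i ≠ j.succ) : flowSwapAt φ j x i = x i := by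
  unfold flowSwapAt; rw [update_of_ne h2, update_of_ne h1]

omit [Fintype S] [DecidableEq S] in
/-- **The flow swap is an involution.** [ours] -/
theorem flowSwapAt_flowSwapAt (φ : Fin K → Equiv.Perm S) (j : Fin K) (x : Fin (K + 1) → S) :
    flowSwapAt φ j (flowSwapAt φ j x) = x := by
  have hne : j.castSucc ≠ j.succ := ne_of_lt Fin.castSucc_lt_succ
  funext i
  by_cases h2 : i = j.succ
  · subst h2; rw [flowSwapAt_succ, flowSwapAt_castSucc, Equiv.apply_symm_apply]
  · by_cases h1 : i = j.castSucc
    · subst h1; rw [flowSwapAt_castSucc, flowSwapAt_succ, Equiv.symm_apply_apply]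
    · rw [flowSwapAt_of_ne φ j _ h1 h2, flowSwapAt_of_ne φ j _ h1 h2]

omit [Fintype S] [DecidableEq S] in
/-- **With identity maps the flow swap is the plain exchange** `x ∘ levelSwap j`. [ours] -/
theorem flowSwapAt_refl (j : Fin K) (x : Fin (K + 1) → S) :
    flowSwapAt (fun _ : Fin K => Equiv.refl S) j x = x ∘ levelSwap j := by
  have hne : j.castSucc ≠ j.succ := ne_of_lt Fin.castSucc_lt_succ
  funext i
  simp only [Function.comp_apply]
  unfold levelSwap
  by_cases h2 : i = j.succ
  · subst h2; rw [flowSwapAt_succ, Equiv.swap_apply_right]; rfl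
  · by_cases h1 : i = j.castSucc
    · subst h1; rw [flowSwapAt_castSucc, Equiv.swap_apply_left]; rfl
    · rw [flowSwapAt_of_ne _ j _ h1 h2, Equiv.swap_apply_of_ne_of_ne h1 h2]

omit [Fintype S] [DecidableEq S] in
/-- `y` is the flow swap of `x` iff `x` is the flow swap of `y`. [ours] -/
theorem eq_flowSwapAt_comm (φ : Fin K → Equiv.Perm S) (j : Fin K) (x y : Fin (K + 1) → S) :
    y = flowSwapAt φ j x ↔ x = flowSwapAt φ j y := by
  constructor
  · intro h; rw [h, flowSwapAt_flowSwapAt]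
  · intro h; rw [h, flowSwapAt_flowSwapAt]

/-- The flow-swap proposal: a uniformly chosen adjacent pair is flow-swapped. [ours] -/
def ptFlowProposal (φ : Fin K → Equiv.Perm S) (x y : Fin (K + 1) → S) : ℝ :=
  ∑ j : Fin K, if y = flowSwapAt φ j x then (1 : ℝ) / K else 0

omit [Fintype S] in
/-- The proposal is symmetric (the move is an involution). [ours] -/
theorem ptFlowProposal_symm (φ : Fin K → Equiv.Perm S) (x y : Fin (K + 1) → S) :
    ptFlowProposal φ x y = ptFlowProposal φ y x := by
  unfold ptFlowProposal
  exact sum_congr rfl fun j _ => by rw [if_congr (eq_flowSwapAt_comm φ j x y) rfl rfl]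

omit [Fintype S] in
/-- The proposal is non-negative. [ours] -/
theorem ptFlowProposal_nonneg (φ : Fin K → Equiv.Perm S) (x y : Fin (K + 1) → S) : 0 ≤ ptFlowProposal φ x y :=
  sum_nonneg fun j _ => by split_ifs <;> positivity

/-- The proposal has row mass `≤ 1`. [ours] -/
theorem sum_ptFlowProposal_le_one (φ : Fin K → Equiv.Perm S) (x : Fin (K + 1) → S) :
    ∑ y, ptFlowProposal φ x y ≤ 1 := by
  unfold ptFlowProposal
  rw [Finset.sum_comm]
  simp_rw [Finset.sum_ite_eq' univ, if_pos (mem_univ _)]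
  rw [Finset.sum_const, Finset.card_univ, Fintype.card_fin, nsmul_eq_mul]
  rcases Nat.eq_zero_or_pos K with h | h
  · subst h; simp
  · rw [mul_one_div_cancel (by exact_mod_cast h.ne')]

omit [Fintype S] in
/-- Each flow swap is proposed with weight at least `1/K`. [ours] -/
theorem ptFlowProposal_flowSwapAt_ge (φ : Fin K → Equiv.Perm S) (j : Fin K) (x : Fin (K + 1) → S) :
    (1 : ℝ) / K ≤ ptFlowProposal φ x (flowSwapAt φ j x) := by
  unfold ptFlowProposal
  calc (1 : ℝ) / K = (if flowSwapAt φ j x = flowSwapAt φ j x then (1 : ℝ) / K else 0) := by rw [if_pos rfl]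
    _ ≤ ∑ i : Fin K, (if flowSwapAt φ j x = flowSwapAt φ i x then (1 : ℝ) / K else 0) :=
      Finset.single_le_sum (f := fun i : Fin K => if flowSwapAt φ j x = flowSwapAt φ i x then (1 : ℝ) / K else 0)
        (fun i _ => by split_ifs <;> positivity) (mem_univ j)

omit [Fintype S] in
/-- With identity maps the proposal is the plain swap proposal. [ours] -/
theorem ptFlowProposal_refl (x y : Fin (K + 1) → S) :
    ptFlowProposal (fun _ : Fin K => Equiv.refl S) x y = ptBareProposal x y := by
  unfold ptFlowProposal ptBareProposal
  exact sum_congr rfl fun j _ => by rw [flowSwapAt_refl]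

/-! ## §2 The Metropolis flow swap and the sampler -/

/-- THE METROPOLIS FLOW-SWAP MOVE: `mhKernel` of the flow-swap proposal for the product law. [ours] -/
def ptFlowSwap (μ : Fin (K + 1) → S → ℝ) (φ : Fin K → Equiv.Perm S) :
    Matrix (Fin (K + 1) → S) (Fin (K + 1) → S) ℝ :=
  mhKernel (ptFlowProposal φ) (tensorFun μ)

/-- THE FLOW-ASSISTED REPLICA-EXCHANGE SAMPLER: with probability `t` a Metropolis flow swap of a uniform adjacent pair,
with probability `1 − t` an update of a uniform replica with its own kernel. [ours] -/
def ptFlowSampler (t : ℝ) (μ : Fin (K + 1) → S → ℝ) (M : Fin (K + 1) → S → S → ℝ) (φ : Fin K → Equiv.Perm S) :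
    Matrix (Fin (K + 1) → S) (Fin (K + 1) → S) ℝ :=
  Matrix.of fun x y =>
    t * ptFlowSwap μ φ x y + (1 - t) * prodKernel (fun _ : Fin (K + 1) => (1 : ℝ) / (K + 1)) M x y

section Basic

variable {μ : Fin (K + 1) → S → ℝ} {M : Fin (K + 1) → S → S → ℝ} {t : ℝ} {φ : Fin K → Equiv.Perm S}

/-- The flow-swap move is in detailed balance with the product law. [ours] -/
theorem ptFlowSwap_detailedBalance (hμ : ∀ k x, 0 < μ k x) : DetailedBalance (tensorFun μ) (ptFlowSwap μ φ) :=
  mhKernel_detailedBalance (tensorFun_pos hμ) _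

/-- The flow-swap move is a transition matrix. [ours] -/
theorem ptFlowSwap_isRowStochastic (hμ : ∀ k x, 0 < μ k x) : IsRowStochastic (ptFlowSwap μ φ) :=
  ⟨mhKernel_nonneg (ptFlowProposal_nonneg φ) (sum_ptFlowProposal_le_one φ) (tensorFun_pos hμ),
    mhKernel_sum_eq_one _ _⟩

/-- Off the diagonal, `π̃(x)·FSw(x,y) = T(x,y)·min{π̃(x), π̃(y)}`. [ours] -/
theorem tensorFun_mul_ptFlowSwap (hμ : ∀ k x, 0 < μ k x) {x y : Fin (K + 1) → S} (hyx : y ≠ x) :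
    tensorFun μ x * ptFlowSwap μ φ x y = ptFlowProposal φ x y * min (tensorFun μ x) (tensorFun μ y) := by
  unfold ptFlowSwap
  rw [mhKernel_of_ne hyx, mul_mhRate (tensorFun_pos hμ), ptFlowProposal_symm φ y x,
    ← min_mul_of_nonneg _ _ (ptFlowProposal_nonneg φ x y), mul_comm]

/-- Entries of the sampler. [ours] -/
theorem ptFlowSampler_apply (t : ℝ) (μ : Fin (K + 1) → S → ℝ) (M : Fin (K + 1) → S → S → ℝ)
    (φ : Fin K → Equiv.Perm S) (x y : Fin (K + 1) → S) :
    ptFlowSampler t μ M φ x y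
      = t * ptFlowSwap μ φ x y + (1 - t) * prodKernel (fun _ : Fin (K + 1) => (1 : ℝ) / (K + 1)) M x y := rfl

/-- The sampler is a transition matrix (`0 ≤ t ≤ 1`, `M_k` row-stochastic). [ours] -/
theorem ptFlowSampler_isRowStochastic (hμ : ∀ k x, 0 < μ k x) (hM : ∀ k, IsRowStochastic (M k))
    (ht0 : 0 ≤ t) (ht1 : t ≤ 1) : IsRowStochastic (ptFlowSampler t μ M φ) := by
  have hU := prodKernel_isRowStochastic M (fun _ : Fin (K + 1) => (1 : ℝ) / (K + 1)) (fun _ => by positivity)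
    (sum_uniform_weight K) hM
  refine ⟨fun x y => ?_, fun x => ?_⟩
  · rw [ptFlowSampler_apply]
    exact add_nonneg (mul_nonneg ht0 ((ptFlowSwap_isRowStochastic (φ := φ) hμ).1 x y))
      (mul_nonneg (by linarith) (hU.1 x y))
  · simp_rw [ptFlowSampler_apply]
    rw [Finset.sum_add_distrib, ← Finset.mul_sum, ← Finset.mul_sum, (ptFlowSwap_isRowStochastic (φ := φ) hμ).2 x,
      hU.2 x]
    ring

omit [Fintype S] in
/-- **The sampler is in DETAILED BALANCE with the product law** — the flow-assisted scheme is EXACT. [ours] -/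
theorem ptFlowSampler_detailedBalance [Fintype S] (hμ : ∀ k x, 0 < μ k x)
    (hMrev : ∀ k, DetailedBalance (μ k) (M k)) :
    DetailedBalance (tensorFun μ) (ptFlowSampler t μ M φ) := by
  intro x y
  rw [ptFlowSampler_apply, ptFlowSampler_apply]
  have h1 := ptFlowSwap_detailedBalance (φ := φ) hμ x y
  have h2 := prodKernel_detailedBalance hMrev (fun _ : Fin (K + 1) => (1 : ℝ) / (K + 1)) x y
  calc tensorFun μ x * (t * ptFlowSwap μ φ x y + (1 - t) * prodKernel (fun _ => (1 : ℝ) / (K + 1)) M x y)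
      = t * (tensorFun μ x * ptFlowSwap μ φ x y)
        + (1 - t) * (tensorFun μ x * prodKernel (fun _ => (1 : ℝ) / (K + 1)) M x y) := by ring
    _ = t * (tensorFun μ y * ptFlowSwap μ φ y x)
        + (1 - t) * (tensorFun μ y * prodKernel (fun _ => (1 : ℝ) / (K + 1)) M y x) := by rw [h1, h2]
    _ = tensorFun μ y * (t * ptFlowSwap μ φ y x + (1 - t) * prodKernel (fun _ => (1 : ℝ) / (K + 1)) M y x) := by
        ring

/-- The product law is stationary for the flow-assisted sampler. [ours] -/
theorem ptFlowSampler_isStationary (hμ : ∀ k x, 0 < μ k x) (hM : ∀ k, IsRowStochastic (M k))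
    (hMrev : ∀ k, DetailedBalance (μ k) (M k)) (ht0 : 0 ≤ t) (ht1 : t ≤ 1) :
    IsStationary (tensorFun μ) (ptFlowSampler t μ M φ) :=
  (ptFlowSampler_detailedBalance hμ hMrev).isStationary (ptFlowSampler_isRowStochastic hμ hM ht0 ht1).2

/-- The flow-assisted sampler dominates the slowed product chain entrywise: `P(x,y) ≥ (1−t)·prodKernel(x,y)`. [ours] -/
theorem ptFlowSampler_ge_update (hμ : ∀ k x, 0 < μ k x) (ht0 : 0 ≤ t) (x y : Fin (K + 1) → S) :
    (1 - t) * prodKernel (fun _ : Fin (K + 1) => (1 : ℝ) / (K + 1)) M x y ≤ ptFlowSampler t μ M φ x y := by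
  rw [ptFlowSampler_apply]
  have : 0 ≤ t * ptFlowSwap μ φ x y := mul_nonneg ht0 ((ptFlowSwap_isRowStochastic (φ := φ) hμ).1 x y)
  linarith

/-- **With identity maps the flow-swap move is the plain swap move.** [ours] -/
theorem ptFlowSwap_refl (μ : Fin (K + 1) → S → ℝ) :
    ptFlowSwap μ (fun _ : Fin K => Equiv.refl S) = ptBareSwap μ := by
  unfold ptFlowSwap ptBareSwap
  have h : (ptFlowProposal (fun _ : Fin K => Equiv.refl S) : (Fin (K + 1) → S) → (Fin (K + 1) → S) → ℝ)
      = ptBareProposal := by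
    funext x y; exact ptFlowProposal_refl x y
  rw [h]

/-- **With identity maps the flow-assisted sampler IS the tagless replica-exchange sampler.** [ours] -/
theorem ptFlowSampler_refl (t : ℝ) (μ : Fin (K + 1) → S → ℝ) (M : Fin (K + 1) → S → S → ℝ) :
    ptFlowSampler t μ M (fun _ : Fin K => Equiv.refl S) = ptBareSampler t μ M := by
  ext x y
  rw [ptFlowSampler_apply, ptBareSampler_apply, ptFlowSwap_refl]

end Basic

end Summit.Ventures.LatticeQCDFlow.Scaling

end
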